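/-
Copyright (c) 2026. All rights reserved.
Released under Apache 2.0 license as described in the file LICENSE.
-/
import Literature.AlgebraicGeometry.ComplexMultiplication.HyperellipticJacobianQuadraticReflexSeparation
import Literature.AlgebraicGeometry.ComplexMultiplication.HyperellipticJacobianLevelTwelveJacobian
import HarnessLib

/-!
# The second exceptional level: `J_{24} ∼ X_3² × X_4³ × Y_8² × Y_{24}⁴` and
# `End⁰(J_{24}) ≅ Mat₂(ℚ(ζ_3)) × Mat₃(ℚ(i)) × Mat₂(ℚ(√−2)) × Mat₄(ℚ(√−6))`, of dimension `66`, `dim J_{24} = 11`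

Layer `Literature/AlgebraicGeometry/ComplexMultiplication`, namespace `…ComplexMultiplication.HyperellipticJacobian`; the sequel of
`HyperellipticJacobianLevelTwelveJacobian` (F15: the blocks `X_3 ⊕ X_6`, `X_4 ⊕ X_{12}` of `J_{12}`), `HyperellipticJacobianQuadraticReflexSeparation`
(F17: `Y_8 ⟂ Y_{24}`, `X_3, X_6 ⟂ Y_{24}`), `HyperellipticJacobianLevelTwenty` (F16: `X_4, Y_{12} ⟂ Y_{24}`), `HyperellipticJacobianCrossLevelOrthogonality`
(F12) and `HyperellipticJacobianEndomorphismAlgebras` (F9: `End⁰(X_8) ≅ Mat₂(ℚ(ζ_8 − ζ_8⁻¹))`, `End⁰(X_{24}) ≅ Mat₄(F_{24})`).  THEOREMS ONLY.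

## The print

A. Gallese, H. Goodson, D. Lombardo, arXiv:2405.20394 [GalleseGoodsonLombardo2024] (held `paper:arxiv-2405.20394`, p0012, p0015 L1–L6): THM. 3.0 and
§3.5 LEMMA 14 with the sentence following it («the geometric endomorphism algebra of `J_m`»).  For `m = 24` the divisors `d ∉ {1, 2}` are
`3, 4, 6, 8, 12, 24`: `J_{24} ∼ X_3 × X_4 × X_6 × X_8 × X_{12} × X_{24}` with `X_6 ∼ X_3`, `X_{12} ∼ X_4²` (F14), `X_8 ∼ Y_8²`, `X_{24} ∼ Y_{24}⁴`, so
`J_{24} ∼ X_3² × X_4³ × Y_8² × Y_{24}⁴` and — the four blocks being pairwise orthogonal (F12, F15, F16, F17) —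
`End⁰(J_{24}) ≅ Mat₂(ℚ(ζ_3)) × Mat₃(ℚ(i)) × Mat₂(ℚ(√−2)) × Mat₄(ℚ(√−6))`, of dimension `8 + 18 + 8 + 32 = 66`; `dim J_{24} = 2 + 3 + 2 + 4 = 11 = g(C_{24})`.
(Reading the printed list with `Y_4 = X_4` and `Y_{12}` as distinct factors would give `… × ℚ(i) × Mat₂(ℚ(i)) × …`, of dimension `58`.)

## What is proved

`hom_eq_zero_blocks_twentyFour` (the blocks `A₃ ⊕ A₆`, `A₄ ⊕ A₁₂`, `A₈`, `A₂₄` of the carrier are pairwise orthogonal),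
**`nonempty_endAlgebra_algEquiv_twentyFourJacobian`** (`End⁰(J) ≃ₐ[ℚ] Mat₂(ℚ(ζ_3)) × (Mat₃(ℚ(ζ_4)) × (Mat₂(ℚ(ζ_8 − ζ_8⁻¹)) × Mat₄(ℚ(r))))`,
`r = ζ + ζ⁵ + ζ⁷ + ζ¹¹`, `r² = −6`), **`finrank_endAlgebra_twentyFourJacobian`** (`dim_ℚ = 66`, `dim J = 11`).

## Honest column ∕ NOT here

The curve; the flat carrier `⨁ ![A₃, A₆, A₄, A₁₂, A₈, A₂₄]` (a re-indexing away); `J_{60}` (`X_5` vs `Y_{60}` untyped).  `HC_CM` is not touched.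

## References

* [GalleseGoodsonLombardo2024] arXiv:2405.20394 — §3 Thm. 3.0, §3.5 Lemma 14 and the sentence following it, §3.4.
* [MumfordAV1970] D. Mumford — §19 Thm. 3 Cor. 1–2, p. 174.
* [Shimura1998] G. Shimura — §5.1 Prop. 3, Prop. 6.
* [MilneCM2006] J. S. Milne — Ch. I §3 Prop. 3.13.

## Provenance

Cell `pub-hodgecm2` (COR-CM), KEPT Literature lane `lit-deligne-3` gen 51 (claim GGL24-LEVEL-TWENTYFOUR-JACOBIAN; count-neutral, own lane).
-/

noncomputable section

open CategoryTheory CategoryTheory.Limits NumberField Module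

namespace Literature.AlgebraicGeometry.ComplexMultiplication

open Literature.AlgebraicGeometry.Motives
open Literature.AlgebraicGeometry.HodgeTheory (complexBetti)
open Literature.NumberTheory.ComplexMultiplication

namespace HyperellipticJacobian

open Literature.AlgebraicGeometry.Pohlmann1968 Literature.AlgebraicGeometry.Pohlmann1968.Cyclotomic

section TwentyFourJacobian

variable {K₃ : Type} [Field K₃] [NumberField K₃] [IsCyclotomicExtension {3} ℚ K₃] {Φ₃ : CMType K₃}
  {A₃ : AbelianVariety ℂ} {ι₃ : 𝓞 K₃ →+* End A₃} {θ₃ : K₃ →+* Module.End ℂ (complexBetti A₃.X 1)}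
  {L : Type} [Field L] [NumberField L] [IsCyclotomicExtension {2 * 3} ℚ L] {Ψ : CMType L}
  {A₆ : AbelianVariety ℂ} {ι₆ : 𝓞 L →+* End A₆} {θ₆ : L →+* Module.End ℂ (complexBetti A₆.X 1)}
  {K₄ : Type} [Field K₄] [NumberField K₄] [IsCyclotomicExtension {4} ℚ K₄] {Φ₄ : CMType K₄}
  {A₄ : AbelianVariety ℂ} {ι₄ : 𝓞 K₄ →+* End A₄} {θ₄ : K₄ →+* Module.End ℂ (complexBetti A₄.X 1)}
  {K₁₂ : Type} [Field K₁₂] [NumberField K₁₂] [IsCyclotomicExtension {12} ℚ K₁₂] {Φ₁₂ : CMType K₁₂}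
  {A₁₂ : AbelianVariety ℂ} {ι₁₂ : 𝓞 K₁₂ →+* End A₁₂} {θ₁₂ : K₁₂ →+* Module.End ℂ (complexBetti A₁₂.X 1)}
  {K₈ : Type} [Field K₈] [NumberField K₈] [IsCyclotomicExtension {8} ℚ K₈] {Φ₈ : CMType K₈}
  {A₈ : AbelianVariety ℂ} {ι₈ : 𝓞 K₈ →+* End A₈} {θ₈ : K₈ →+* Module.End ℂ (complexBetti A₈.X 1)}
  {K : Type} [Field K] [NumberField K] [IsCyclotomicExtension {24} ℚ K] {Φ' : CMType K}
  {A' : AbelianVariety ℂ} {ι' : 𝓞 K →+* End A'} {θ' : K →+* Module.End ℂ (complexBetti A'.X 1)}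

/-- **The blocks `X_3 ⊕ X_6`, `X_4 ⊕ X_{12}`, `X_8`, `X_{24}` of `J_{24}` are pairwise orthogonal** (F15: the first two; F12: `X_3, X_6 ⟂ X_8`,
`X_4, X_{12} ⟂ X_8`; F16: `X_4, X_{12} ⟂ Y_{24}`; F17: `X_3, X_6 ⟂ Y_{24}`, `Y_8 ⟂ Y_{24}`).
[cite: GalleseGoodsonLombardo2024, §3 Thm. 3.0 (last statement)] [cite: MilneCM2006, Ch. I §3 Prop. 3.13] -/
theorem hom_eq_zero_blocks_twentyFour (hΦ₃ : ∀ σ : K₃ →+* ℂ, σ ∈ Φ₃.1 ↔ 2 * (expOf 3 K₃ σ).val < 3)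
    (hA₃ : IsCMTypeRealisation Φ₃ A₃ ι₃ θ₃)
    (hΨ : ∀ σ : L →+* ℂ, σ ∈ Ψ.1 ↔ 2 * (expOf (2 * 3) L σ).val < 2 * 3) (hA₆ : IsCMTypeRealisation Ψ A₆ ι₆ θ₆)
    (hA₄ : IsCMTypeRealisation Φ₄ A₄ ι₄ θ₄)
    (hΦ₁₂ : ∀ σ : K₁₂ →+* ℂ, σ ∈ Φ₁₂.1 ↔ 2 * (expOf 12 K₁₂ σ).val < 12) (hA₁₂ : IsCMTypeRealisation Φ₁₂ A₁₂ ι₁₂ θ₁₂)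
    (hΦ₈ : ∀ σ : K₈ →+* ℂ, σ ∈ Φ₈.1 ↔ 2 * (expOf 8 K₈ σ).val < 8) (hA₈ : IsCMTypeRealisation Φ₈ A₈ ι₈ θ₈)
    (hΦ' : ∀ σ : K →+* ℂ, σ ∈ Φ'.1 ↔ 2 * (expOf 24 K σ).val < 24) (hA' : IsCMTypeRealisation Φ' A' ι' θ') :
    ∀ i j : Fin 4, i ≠ j →
      ∀ f : (![⨁ fun l : Fin 2 => (![A₃, A₆] : Fin 2 → AbelianVariety ℂ) l, ⨁ fun l : Fin 2 => (![A₄, A₁₂] : Fin 2 → AbelianVariety ℂ) l,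
              A₈, A'] : Fin 4 → AbelianVariety ℂ) i ⟶
        (![⨁ fun l : Fin 2 => (![A₃, A₆] : Fin 2 → AbelianVariety ℂ) l, ⨁ fun l : Fin 2 => (![A₄, A₁₂] : Fin 2 → AbelianVariety ℂ) l,
          A₈, A'] : Fin 4 → AbelianVariety ℂ) j, f = 0 := by
  haveI : NeZero (3 : ℕ) := ⟨by norm_num⟩
  haveI : NeZero (2 * 3 : ℕ) := ⟨by norm_num⟩
  haveI : NeZero (8 : ℕ) := ⟨by norm_num⟩
  haveI : NeZero (12 : ℕ) := ⟨by norm_num⟩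
  have hodd : Odd 3 := by decide
  have h48 : 4 ∣ 8 := ⟨2, rfl⟩
  have h88 : 8 ∣ 8 := dvd_refl 8
  have h412 : 4 ∣ 12 := ⟨3, rfl⟩
  have h8n12 : ¬ 8 ∣ 12 := by decide
  -- the twelve orthogonality relations
  have h12 := hom_eq_zero_blocks_twelve hΦ₃ hA₃ hΨ hA₆ hA₄ hΦ₁₂ hA₁₂
  have o38 := orthogonal_odd_fourDvd hodd le_rfl hΦ₃ hA₃ h48 le_rfl (by norm_num) (by norm_num) (by norm_num) hΦ₈ hA₈
  have o68 := orthogonal_twiceOdd_fourDvd hodd le_rfl hΨ hA₆ h48 le_rfl (by norm_num) (by norm_num) (by norm_num) hΦ₈ hA₈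
  have o3' := orthogonal_odd_twentyFour_of_three_dvd hodd (dvd_refl 3) hΦ₃ hA₃ hΦ' hA'
  have o6' := orthogonal_twiceOdd_twentyFour_of_three_dvd hodd le_rfl (dvd_refl 3) hΨ hA₆ hΦ' hA'
  have o48 := orthogonal_four_fourDvd_of_eight_dvd hA₄ h88 (by norm_num) hΦ₈ hA₈
  have o812 := orthogonal_fourDvd_of_eight_dvd_of_not_eight_dvd h88 (by norm_num) hΦ₈ hA₈ h412 (by norm_num) (by norm_num) (by norm_num)
    h8n12 hΦ₁₂ hA₁₂
  have o4' := orthogonal_four_twentyFour hA₄ hΦ' hA'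
  have o12' := orthogonal_fourDvd_twentyFour_of_not_eight_dvd h412 (by norm_num) (by norm_num) (by norm_num) h8n12 hΦ₁₂ hA₁₂ hΦ' hA'
  have o8' := orthogonal_eight_twentyFour hΦ₈ hA₈ hΦ' hA'
  have hinM : ∀ {P Q Z : AbelianVariety ℂ}, (∀ u : Z ⟶ P, u = 0) → (∀ u : Z ⟶ Q, u = 0) →
      ∀ f : Z ⟶ ⨁ fun l : Fin 2 => (![P, Q] : Fin 2 → AbelianVariety ℂ) l, f = 0 := by
    intro P Q Z h0 h1 f
    refine biproduct.hom_ext _ _ fun l => ?_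
    rw [Limits.zero_comp]
    match l with
    | ⟨0, _⟩ => exact h0 _
    | ⟨1, _⟩ => exact h1 _
  have houtM : ∀ {P Q Z : AbelianVariety ℂ}, (∀ u : P ⟶ Z, u = 0) → (∀ u : Q ⟶ Z, u = 0) →
      ∀ f : (⨁ fun l : Fin 2 => (![P, Q] : Fin 2 → AbelianVariety ℂ) l) ⟶ Z, f = 0 := by
    intro P Q Z h0 h1 f
    refine biproduct.hom_ext' _ _ fun l => ?_
    rw [Limits.comp_zero]
    match l with
    | ⟨0, _⟩ => exact h0 _
    | ⟨1, _⟩ => exact h1 _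
  intro i j hij f
  match i, j with
  | ⟨0, _⟩, ⟨0, _⟩ => exact absurd rfl hij
  | ⟨1, _⟩, ⟨1, _⟩ => exact absurd rfl hij
  | ⟨2, _⟩, ⟨2, _⟩ => exact absurd rfl hij
  | ⟨3, _⟩, ⟨3, _⟩ => exact absurd rfl hij
  | ⟨0, _⟩, ⟨1, _⟩ => exact h12 0 1 (by decide) f
  | ⟨1, _⟩, ⟨0, _⟩ => exact h12 1 0 (by decide) f
  | ⟨0, _⟩, ⟨2, _⟩ => exact houtM o38.1 o68.1 f
  | ⟨2, _⟩, ⟨0, _⟩ => exact hinM o38.2.1 o68.2.1 f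
  | ⟨0, _⟩, ⟨3, _⟩ => exact houtM o3'.1 o6'.1 f
  | ⟨3, _⟩, ⟨0, _⟩ => exact hinM o3'.2.1 o6'.2.1 f
  | ⟨1, _⟩, ⟨2, _⟩ => exact houtM o48.1 o812.2.1 f
  | ⟨2, _⟩, ⟨1, _⟩ => exact hinM o48.2.1 o812.1 f
  | ⟨1, _⟩, ⟨3, _⟩ => exact houtM o4'.1 o12'.1 f
  | ⟨3, _⟩, ⟨1, _⟩ => exact hinM o4'.2.1 o12'.2.1 f
  | ⟨2, _⟩, ⟨3, _⟩ => exact o8'.1 f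
  | ⟨3, _⟩, ⟨2, _⟩ => exact o8'.2.1 f

/-- The product of four algebras indexed by `Fin 4` (`∏_{i : Fin 4} T_i ≃ₐ T₀ × (T₁ × (T₂ × T₃))`). [folklore] -/
private theorem nonempty_pi_fin_four_algEquiv_prod (T : Fin 4 → Type) [∀ i, Ring (T i)] [∀ i, Algebra ℚ (T i)] :
    Nonempty ((∀ i, T i) ≃ₐ[ℚ] T 0 × (T 1 × (T 2 × T 3))) := by
  refine ⟨AlgEquiv.ofBijective
    ((Pi.evalAlgHom ℚ T 0).prod ((Pi.evalAlgHom ℚ T 1).prod ((Pi.evalAlgHom ℚ T 2).prod (Pi.evalAlgHom ℚ T 3))))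
    ⟨fun f g h => ?_, fun x => ?_⟩⟩
  · simp only [AlgHom.prod_apply, Pi.evalAlgHom_apply, Prod.mk.injEq] at h
    funext i
    match i with
    | ⟨0, _⟩ => exact h.1
    | ⟨1, _⟩ => exact h.2.1
    | ⟨2, _⟩ => exact h.2.2.1
    | ⟨3, _⟩ => exact h.2.2.2
  · exact ⟨Fin.cons x.1 (Fin.cons x.2.1 (Fin.cons x.2.2.1 (Fin.cons x.2.2.2 finZeroElim))), rfl⟩

/-- **GGL THM. 3.0 + LEMMA 14 at the exceptional level `24`:
`End⁰(J_{24}) ≃ₐ[ℚ] Mat₂(ℚ(ζ_3)) × (Mat₃(ℚ(ζ_4)) × (Mat₂(ℚ(ζ_8 − ζ_8⁻¹)) × Mat₄(ℚ(r))))`**, `(ζ_8 − ζ_8⁻¹)² = −2`, `r = ζ + ζ⁵ + ζ⁷ + ζ¹¹`, `r² = −6`,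
on the carrier `⨁_{Fin 4} ![A₃ ⊕ A₆, A₄ ⊕ A₁₂, A₈, A₂₄]`: the blocks are pairwise orthogonal; `End⁰(A₃ ⊕ A₆) ≅ Mat₂(ℚ(ζ_3))`,
`End⁰(A₄ ⊕ A₁₂) ≅ Mat₃(ℚ(ζ_4))` (F15), `End⁰(A₈) ≅ Mat₂(ℚ(ζ_8 − ζ_8⁻¹))`, `End⁰(A₂₄) ≅ Mat₄(ℚ(r))` (Lemma 14 (2), (3), F9).
[cite: GalleseGoodsonLombardo2024, §3.5 Lemma 14 and the sentence following it; §3 Thm. 3.0 (4)–(6) and last statement; §3.4]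
[cite: MumfordAV1970, §19 Cor. 2 of Thm. 3 and p. 174] [cite: Shimura1998, §5.1 Prop. 3 (proof) and Prop. 6] -/
theorem nonempty_endAlgebra_algEquiv_twentyFourJacobian (hΦ₃ : ∀ σ : K₃ →+* ℂ, σ ∈ Φ₃.1 ↔ 2 * (expOf 3 K₃ σ).val < 3)
    (hA₃ : IsCMTypeRealisation Φ₃ A₃ ι₃ θ₃)
    (hΨ : ∀ σ : L →+* ℂ, σ ∈ Ψ.1 ↔ 2 * (expOf (2 * 3) L σ).val < 2 * 3) (hA₆ : IsCMTypeRealisation Ψ A₆ ι₆ θ₆)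
    (hΦ₄ : ∀ σ : K₄ →+* ℂ, σ ∈ Φ₄.1 ↔ 2 * (expOf 4 K₄ σ).val < 4) (hA₄ : IsCMTypeRealisation Φ₄ A₄ ι₄ θ₄)
    (hΦ₁₂ : ∀ σ : K₁₂ →+* ℂ, σ ∈ Φ₁₂.1 ↔ 2 * (expOf 12 K₁₂ σ).val < 12) (hA₁₂ : IsCMTypeRealisation Φ₁₂ A₁₂ ι₁₂ θ₁₂)
    (hΦ₈ : ∀ σ : K₈ →+* ℂ, σ ∈ Φ₈.1 ↔ 2 * (expOf 8 K₈ σ).val < 8) (hA₈ : IsCMTypeRealisation Φ₈ A₈ ι₈ θ₈)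
    (hΦ' : ∀ σ : K →+* ℂ, σ ∈ Φ'.1 ↔ 2 * (expOf 24 K σ).val < 24) (hA' : IsCMTypeRealisation Φ' A' ι' θ') :
    Nonempty ((⨁ fun i : Fin 4 =>
        (![⨁ fun l : Fin 2 => (![A₃, A₆] : Fin 2 → AbelianVariety ℂ) l, ⨁ fun l : Fin 2 => (![A₄, A₁₂] : Fin 2 → AbelianVariety ℂ) l,
          A₈, A'] : Fin 4 → AbelianVariety ℂ) i).endAlgebra ≃ₐ[ℚ]
      Matrix (Fin 2) (Fin 2) K₃ × (Matrix (Fin 3) (Fin 3) K₄ ×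
        (Matrix (Fin 2) (Fin 2) (IntermediateField.adjoin ℚ {zetaOf 8 K₈ - (zetaOf 8 K₈)⁻¹}) ×
          Matrix (Fin 4) (Fin 4) (IntermediateField.adjoin ℚ {zetaOf 24 K + zetaOf 24 K ^ 5 + zetaOf 24 K ^ 7 + zetaOf 24 K ^ 11})))) := by
  classical
  haveI : NeZero (8 : ℕ) := ⟨by norm_num⟩
  obtain ⟨E, -⟩ := AbelianVariety.nonempty_algEquiv_endAlgebra_biproduct_pi
    (A := fun i : Fin 4 => (![⨁ fun l : Fin 2 => (![A₃, A₆] : Fin 2 → AbelianVariety ℂ) l,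
      ⨁ fun l : Fin 2 => (![A₄, A₁₂] : Fin 2 → AbelianVariety ℂ) l, A₈, A'] : Fin 4 → AbelianVariety ℂ) i)
    (hom_eq_zero_blocks_twentyFour hΦ₃ hA₃ hΨ hA₆ hA₄ hΦ₁₂ hA₁₂ hΦ₈ hA₈ hΦ' hA')
  obtain ⟨P⟩ := nonempty_pi_fin_four_algEquiv_prod
    (fun i : Fin 4 => ((![⨁ fun l : Fin 2 => (![A₃, A₆] : Fin 2 → AbelianVariety ℂ) l,
      ⨁ fun l : Fin 2 => (![A₄, A₁₂] : Fin 2 → AbelianVariety ℂ) l, A₈, A'] : Fin 4 → AbelianVariety ℂ) i).endAlgebra)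
  obtain ⟨e₀⟩ := nonempty_endAlgebra_three_six_algEquiv_matrix hΦ₃ hA₃ hΨ hA₆
  obtain ⟨e₁⟩ := nonempty_endAlgebra_four_twelve_algEquiv_matrix hΦ₄ hA₄ hΦ₁₂ hA₁₂
  obtain ⟨-, ⟨e₂⟩, -⟩ := nonempty_matrix_two_algEquiv_endAlgebra_of_four_dvd ⟨2, rfl⟩ le_rfl (by norm_num) (by norm_num) (by norm_num)
    Φ₈ hΦ₈ hA₈
  obtain ⟨-, -, -, ⟨e₃⟩, -⟩ := nonempty_matrix_four_algEquiv_endAlgebra_twentyFour Φ' hΦ' hA'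
  exact ⟨(E.trans P).trans (AlgEquiv.prodCongr e₀ (AlgEquiv.prodCongr e₁ (AlgEquiv.prodCongr e₂.symm e₃.symm)))⟩

omit [IsCyclotomicExtension {4} ℚ K₄] in
/-- `[ℚ(ζ_4) : ℚ] = 2`. [folklore] -/
private theorem finrank_eq_two_four_x [IsCyclotomicExtension {4} ℚ K₄] : finrank ℚ K₄ = 2 := by
  haveI : NeZero (4 : ℕ) := ⟨by norm_num⟩
  rw [IsCyclotomicExtension.finrank (K := ℚ) (n := 4) K₄ (Polynomial.cyclotomic.irreducible_rat (by norm_num))]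
  decide +kernel

omit [IsCyclotomicExtension {3} ℚ K₃] in
/-- `[ℚ(ζ_3) : ℚ] = 2`. [folklore] -/
private theorem finrank_eq_two_three_x [IsCyclotomicExtension {3} ℚ K₃] : finrank ℚ K₃ = 2 := by
  haveI : NeZero (3 : ℕ) := ⟨by norm_num⟩
  rw [IsCyclotomicExtension.finrank (K := ℚ) (n := 3) K₃ (Polynomial.cyclotomic.irreducible_rat (by norm_num))]
  decide +kernel

/-- **`dim_ℚ End⁰(J_{24}) = 66` and `dim J_{24} = 11 = g(C_{24})`** (`8 + 18 + 8 + 32`; `(1 + 1) + (1 + 2) + 2 + 4`).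
[cite: GalleseGoodsonLombardo2024, §3 Thm. 3.0 and §3.5 Lemma 14] [cite: MumfordAV1970, §19 Cor. 2 of Thm. 3] -/
theorem finrank_endAlgebra_twentyFourJacobian (hΦ₃ : ∀ σ : K₃ →+* ℂ, σ ∈ Φ₃.1 ↔ 2 * (expOf 3 K₃ σ).val < 3)
    (hA₃ : IsCMTypeRealisation Φ₃ A₃ ι₃ θ₃)
    (hΨ : ∀ σ : L →+* ℂ, σ ∈ Ψ.1 ↔ 2 * (expOf (2 * 3) L σ).val < 2 * 3) (hA₆ : IsCMTypeRealisation Ψ A₆ ι₆ θ₆)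
    (hΦ₄ : ∀ σ : K₄ →+* ℂ, σ ∈ Φ₄.1 ↔ 2 * (expOf 4 K₄ σ).val < 4) (hA₄ : IsCMTypeRealisation Φ₄ A₄ ι₄ θ₄)
    (hΦ₁₂ : ∀ σ : K₁₂ →+* ℂ, σ ∈ Φ₁₂.1 ↔ 2 * (expOf 12 K₁₂ σ).val < 12) (hA₁₂ : IsCMTypeRealisation Φ₁₂ A₁₂ ι₁₂ θ₁₂)
    (hΦ₈ : ∀ σ : K₈ →+* ℂ, σ ∈ Φ₈.1 ↔ 2 * (expOf 8 K₈ σ).val < 8) (hA₈ : IsCMTypeRealisation Φ₈ A₈ ι₈ θ₈)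
    (hΦ' : ∀ σ : K →+* ℂ, σ ∈ Φ'.1 ↔ 2 * (expOf 24 K σ).val < 24) (hA' : IsCMTypeRealisation Φ' A' ι' θ') :
    finrank ℚ (⨁ fun i : Fin 4 =>
        (![⨁ fun l : Fin 2 => (![A₃, A₆] : Fin 2 → AbelianVariety ℂ) l, ⨁ fun l : Fin 2 => (![A₄, A₁₂] : Fin 2 → AbelianVariety ℂ) l,
          A₈, A'] : Fin 4 → AbelianVariety ℂ) i).endAlgebra = 66 ∧
    (⨁ fun i : Fin 4 =>
        (![⨁ fun l : Fin 2 => (![A₃, A₆] : Fin 2 → AbelianVariety ℂ) l, ⨁ fun l : Fin 2 => (![A₄, A₁₂] : Fin 2 → AbelianVariety ℂ) l,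
          A₈, A'] : Fin 4 → AbelianVariety ℂ) i).dim = 11 := by
  classical
  haveI : NeZero (8 : ℕ) := ⟨by norm_num⟩
  haveI : NeZero (12 : ℕ) := ⟨by norm_num⟩
  haveI : NeZero (2 * 3 : ℕ) := ⟨by norm_num⟩
  haveI : NeZero (24 : ℕ) := ⟨by norm_num⟩
  obtain ⟨hd', -, hF, -⟩ := nonempty_matrix_four_algEquiv_endAlgebra_twentyFour Φ' hΦ' hA'
  have hK₈ : finrank ℚ K₈ = 4 := by
    rw [IsCyclotomicExtension.finrank (K := ℚ) (n := 8) K₈ (Polynomial.cyclotomic.irreducible_rat (by norm_num))]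
    decide +kernel
  have hF₈ : finrank ℚ (IntermediateField.adjoin ℚ {zetaOf 8 K₈ - (zetaOf 8 K₈)⁻¹}) = 2 := by
    have h4 : 4 ∣ 8 := ⟨2, rfl⟩
    obtain ⟨K₁, Φ₁, h₁, hp₁, -⟩ := exists_primitive_inducedCMType_index_two_of_four_dvd h4 le_rfl (by norm_num) (by norm_num) (by norm_num) Φ₈ hΦ₈
    obtain ⟨-, -, -, -, -, -, -, hdeg, hK₁⟩ :=
      eq_fixedField_and_eq_adjoin_of_primitive_of_four_dvd h4 le_rfl (by norm_num) (by norm_num) (by norm_num) Φ₈ hΦ₈ Φ₁ h₁ hp₁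
    rw [← hK₁]
    have h8 : Nat.totient 8 = 4 := by decide +kernel
    rw [h8] at hdeg
    omega
  refine ⟨?_, ?_⟩
  · obtain ⟨e⟩ := nonempty_endAlgebra_algEquiv_twentyFourJacobian hΦ₃ hA₃ hΨ hA₆ hΦ₄ hA₄ hΦ₁₂ hA₁₂ hΦ₈ hA₈ hΦ' hA'
    haveI : FiniteDimensional ℚ (IntermediateField.adjoin ℚ {zetaOf 24 K + zetaOf 24 K ^ 5 + zetaOf 24 K ^ 7 + zetaOf 24 K ^ 11}) :=
      IntermediateField.finiteDimensional_left _
    haveI : FiniteDimensional ℚ (IntermediateField.adjoin ℚ {zetaOf 8 K₈ - (zetaOf 8 K₈)⁻¹}) :=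
      IntermediateField.finiteDimensional_left _
    haveI : Module.Finite ℚ (Matrix (Fin 4) (Fin 4)
        (IntermediateField.adjoin ℚ {zetaOf 24 K + zetaOf 24 K ^ 5 + zetaOf 24 K ^ 7 + zetaOf 24 K ^ 11})) := Module.Finite.matrix
    haveI : Module.Finite ℚ (Matrix (Fin 2) (Fin 2) (IntermediateField.adjoin ℚ {zetaOf 8 K₈ - (zetaOf 8 K₈)⁻¹})) :=
      Module.Finite.matrix
    haveI : Module.Finite ℚ (Matrix (Fin 3) (Fin 3) K₄) := Module.Finite.matrix
    haveI : Module.Finite ℚ (Matrix (Fin 2) (Fin 2) K₃) := Module.Finite.matrix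
    rw [e.toLinearEquiv.finrank_eq, Module.finrank_prod, Module.finrank_prod, Module.finrank_prod, Module.finrank_matrix,
      Module.finrank_matrix, Module.finrank_matrix, Module.finrank_matrix, Fintype.card_fin, Fintype.card_fin, Fintype.card_fin,
      finrank_eq_two_three_x (K₃ := K₃), finrank_eq_two_four_x (K₄ := K₄), hF₈, hF]
  · have hd₃ : A₃.dim = 1 := by
      have h : A₃.dim = finrank ℚ K₃ / 2 := Motives.schemeDim_eq_holds hA₃.1
      rw [finrank_eq_two_three_x (K₃ := K₃)] at h
      simpa using h
    have hd₆ : A₆.dim = 1 := by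
      have h : A₆.dim = finrank ℚ L / 2 := Motives.schemeDim_eq_holds hA₆.1
      rw [IsCyclotomicExtension.finrank (K := ℚ) (n := 2 * 3) L (Polynomial.cyclotomic.irreducible_rat (by norm_num)),
        show Nat.totient (2 * 3) = 2 by decide +kernel] at h
      simpa using h
    have hd₄ : A₄.dim = 1 := by
      have h : A₄.dim = finrank ℚ K₄ / 2 := Motives.schemeDim_eq_holds hA₄.1
      rw [finrank_eq_two_four_x (K₄ := K₄)] at h
      simpa using h
    have hd₁₂ : A₁₂.dim = 2 := by
      have h : A₁₂.dim = finrank ℚ K₁₂ / 2 := Motives.schemeDim_eq_holds hA₁₂.1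
      rw [IsCyclotomicExtension.finrank (K := ℚ) (n := 12) K₁₂ (Polynomial.cyclotomic.irreducible_rat (by norm_num)),
        show Nat.totient 12 = 4 by decide +kernel] at h
      simpa using h
    have hd₈ : A₈.dim = 2 := by
      have h : A₈.dim = finrank ℚ K₈ / 2 := Motives.schemeDim_eq_holds hA₈.1
      rw [hK₈] at h
      simpa using h
    rw [AbelianVariety.dim_biproduct, Fin.sum_univ_four]
    show (⨁ fun l : Fin 2 => (![A₃, A₆] : Fin 2 → AbelianVariety ℂ) l).dim +
        (⨁ fun l : Fin 2 => (![A₄, A₁₂] : Fin 2 → AbelianVariety ℂ) l).dim + A₈.dim + A'.dim = 11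
    rw [AbelianVariety.dim_biproduct, AbelianVariety.dim_biproduct, Fin.sum_univ_two, Fin.sum_univ_two]
    show A₃.dim + A₆.dim + (A₄.dim + A₁₂.dim) + A₈.dim + A'.dim = 11
    omega

end TwentyFourJacobian

end HyperellipticJacobian

end Literature.AlgebraicGeometry.ComplexMultiplication

end
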